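import Literature.InformationTheory.QuantumCodes.MinWeightDecodingClusters
import Mathlib.Data.Matrix.Basic
import Mathlib.Data.Matrix.Mul
import Mathlib.Algebra.CharP.Two
import Mathlib.Data.Finset.SymmDiff
import Mathlib.Data.Sym.Sym2
import Mathlib.InformationTheory.Hamming
import HarnessLib

/-!
# Graphlike syndrome maps: boundaries of chains, cycles, and the shortest-chain distance

Topic `Literature/InformationTheory/QuantumCodes` (venture QEC, LADDER-QEC rung Q5 «toric/surface + MWPM»;
qec-type-09 gen 4, PARTITION row 09). First of three files (`GraphlikeSyndromes` → `MatchingCost` →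
`MatchingDecoders`) PROVING that minimum-weight perfect matching (MWPM) decoders are minimum-weight decoders
(`Decoder.IsMinWeight`, `SyndromeDecoding.lean`) for every GRAPHLIKE decoding problem — every fault `ℓ`
flips exactly the two ends `ι ℓ = s(a, b)` of a link, a loop `s(a, a)` flips nothing — which is the
Edmonds–Johnson `T`-join theorem as presented by Korte–Vygen §12.2 (Def 12.5: "A set `J ⊆ E(G)` is a
`T`-join if `|J ∩ δ(x)|` is odd if and only if `x ∈ T`"; Thm 12.9) and the standing justification of
matching decoders in Dennis–Kitaev–Landahl–Preskill ("the minimum weight chain with a specified boundary,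
which we know can be computed in a time polynomial in `L` using the perfect matching algorithm of Edmonds",
§4.4 p. 18). This file sets up the vocabulary (all definitions REAL, all lemmas PROVED, 0 facts):

* `pairIndicator p` — the `ℤ₂` indicator `1_a + 1_b` of the ends of `p = s(a, b) : Sym2 V` (`0` on a loop);
* `incMatrix ι` and **`graphSyn ι e = incMatrix ι *ᵥ e`** — the boundary `∂e` (syndrome) of a chain
  `e : E → ℤ₂`, i.e. the set `T` of which `e` is a `T`-join; `graphCycles ι` — chains without boundary;
  `∂` is additive, `∂(1_ℓ) = pairIndicator (ι ℓ)`, `supp (x + 1_a + 1_b) = supp x ∆ {a, b}`;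
* `IsLinkConnected ι` and **`chainDist ι a b`** — the least number of links of a chain with boundary
  `{a, b}` (the lattice / shortest-path distance used as MWPM weight), symmetric, triangle inequality,
  `≤ 1` across a link;
* `ℤ₂` bookkeeping: `supp`, Hamming-weight subadditivity `hammingNorm_add_le_add` / `hammingNorm_sum_le`.
The toric code's star / plaquette / space-time boundary maps are shown to be of this form in
`ToricCodeMatching.lean`.

## References
* [KorteVygen2002] B. Korte, J. Vygen, *Combinatorial Optimization. Theory and Algorithms*, 2nd ed.,
  Springer (2002), §12.2 "T-joins", Def 12.5, Prop 12.6, Lemma 12.8 and Theorem 12.9 (Edmonds–Johnson),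
  pp. 275–277.
* [EdmondsJohnson1973] J. Edmonds, E. L. Johnson, *Matching, Euler tours and the Chinese postman*,
  Math. Programming 5 (1973) 88–124 (the source of Thm 12.9; cited through Korte–Vygen).
* [DennisEtAl2002] E. Dennis, A. Kitaev, A. Landahl, J. Preskill, *Topological quantum memory*, J. Math.
  Phys. 43 (2002) 4452–4505, arXiv:quant-ph/0110143, §4.4 (p. 18) and §5.1 (p. 19).
-/

namespace Literature.InformationTheory.QuantumCodes

open Finset Matrix
open scoped symmDiff

variable {V E : Type*}

/-! ### `ℤ₂` bookkeeping -/

/-- Membership in the support of a binary vector (`supp`, `MinWeightDecodingClusters.lean`). [cite: DennisEtAl2002, §4.4 (the links ℓ with n_E(ℓ) = 1)] -/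
theorem mem_supp_iff [Fintype V] {x : V → ZMod 2} {v : V} : v ∈ supp x ↔ x v ≠ 0 := by
  simp [supp]

/-- A binary vector is the indicator of its support. [cite: DennisEtAl2002, §4.4 (E is characterized by n_E)] -/
theorem indicator_supp [Fintype V] [DecidableEq V] (x : V → ZMod 2) :
    (fun v => if v ∈ supp x then (1 : ZMod 2) else 0) = x := by
  funext v
  have h01 : ∀ y : ZMod 2, y = 0 ∨ y = 1 := by decide
  rcases h01 (x v) with h | h <;> simp [supp, h]

/-- The zero vector has empty support. [cite: DennisEtAl2002, §4.4 (n_E)] -/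
@[simp] theorem supp_zero [Fintype V] : supp (0 : V → ZMod 2) = ∅ := by
  ext v; simp [mem_supp_iff]

/-- The support of a sum is contained in the union of the supports. [cite: KorteVygen2002, §12.2 proof of Thm 12.9 (J := symmetric difference of edge sets)] -/
theorem supp_add_subset [Fintype V] [DecidableEq V] (x y : V → ZMod 2) : supp (x + y) ⊆ supp x ∪ supp y := by
  intro v hv
  rw [mem_union, mem_supp_iff, mem_supp_iff]
  rw [mem_supp_iff, Pi.add_apply] at hv
  by_contra h
  rw [not_or, not_not, not_not] at h
  exact hv (by rw [h.1, h.2, add_zero])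

/-- Subadditivity of the Hamming weight, `|x + y| ≤ |x| + |y|`. [cite: KorteVygen2002, §12.2 proof of Thm 12.9 (c(J) ≤ c̄(M): a symmetric difference weighs at most the sum)] -/
theorem hammingNorm_add_le_add [Fintype V] [DecidableEq V] (x y : V → ZMod 2) :
    hammingNorm (x + y) ≤ hammingNorm x + hammingNorm y :=
  calc hammingNorm (x + y) = (supp (x + y)).card := rfl
    _ ≤ (supp x ∪ supp y).card := card_le_card (supp_add_subset x y)
    _ ≤ (supp x).card + (supp y).card := card_union_le _ _

/-- Subadditivity of the Hamming weight over a finite sum. [cite: KorteVygen2002, §12.2 proof of Thm 12.9 (c(J) ≤ c̄(M))] -/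
theorem hammingNorm_sum_le [Fintype V] [DecidableEq V] {α : Type*} [DecidableEq α] (s : Finset α)
    (f : α → V → ZMod 2) : hammingNorm (∑ i ∈ s, f i) ≤ ∑ i ∈ s, hammingNorm (f i) := by
  induction s using Finset.induction_on with
  | empty => simp
  | insert a s ha ih =>
    rw [sum_insert ha, sum_insert ha]
    exact (hammingNorm_add_le_add _ _).trans (Nat.add_le_add_left ih _)

/-- In characteristic two a chain is its own negative: `e + e = 0`. [cite: DennisEtAl2002, §4.3 (E + E′ as ℤ₂ chains)] -/
theorem chain_add_self (e : E → ZMod 2) : e + e = 0 := by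
  funext ℓ; exact CharTwo.add_self_eq_zero (e ℓ)

/-! ### Graphlike syndrome maps -/

/-- The `ℤ₂`-indicator of the two ends of an unordered pair: `s(a, b) ↦ 1_a + 1_b` (so a loop `s(a, a)`
maps to `0`). [cite: KorteVygen2002, §12.2 Def 12.5 (|J ∩ δ(x)| odd)] -/
def pairIndicator [DecidableEq V] : Sym2 V → V → ZMod 2 :=
  Sym2.lift ⟨fun a b => Pi.single a 1 + Pi.single b 1, fun _ _ => add_comm _ _⟩

/-- `pairIndicator s(a, b) = 1_a + 1_b`. [cite: KorteVygen2002, §12.2 Def 12.5] -/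
@[simp] theorem pairIndicator_mk [DecidableEq V] (a b : V) :
    pairIndicator s(a, b) = Pi.single a 1 + Pi.single b 1 := rfl

/-- A loop has no ends modulo two. [cite: KorteVygen2002, §12.2 Def 12.5 (a loop meets δ(x) an even number of times)] -/
theorem pairIndicator_diag [DecidableEq V] (a : V) : pairIndicator s(a, a) = 0 := by
  rw [pairIndicator_mk, ← Pi.single_add, CharTwo.add_self_eq_zero, Pi.single_zero]

/-- Concatenation: `(1_a + 1_b) + (1_b + 1_c) = 1_a + 1_c`. [cite: KorteVygen2002, §12.2 proof of Prop 12.6 (parity of degrees under E(P₁) △ E(P₂))] -/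
theorem pairIndicator_add_pairIndicator [DecidableEq V] (a b c : V) :
    pairIndicator s(a, b) + pairIndicator s(b, c) = pairIndicator s(a, c) := by
  have hbb : (Pi.single b (1 : ZMod 2) : V → ZMod 2) + Pi.single b 1 = 0 := by
    rw [← Pi.single_add, CharTwo.add_self_eq_zero, Pi.single_zero]
  rw [pairIndicator_mk, pairIndicator_mk, pairIndicator_mk, add_assoc, ← add_assoc (Pi.single b 1), hbb,
    zero_add]

/-- Pointwise value of the indicator of a proper pair. [cite: KorteVygen2002, §12.2 Def 12.5] -/
theorem pairIndicator_apply [DecidableEq V] {a b : V} (hab : a ≠ b) (v : V) :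
    pairIndicator s(a, b) v = if v = a ∨ v = b then 1 else 0 := by
  rw [pairIndicator_mk, Pi.add_apply, Pi.single_apply, Pi.single_apply]
  by_cases hva : v = a
  · subst hva
    simp [hab]
  · by_cases hvb : v = b
    · subst hvb
      simp [hva]
    · simp [hva, hvb]

/-- On a proper pair the indicator detects membership. [cite: KorteVygen2002, §12.2 Def 12.5] -/
theorem pairIndicator_apply_of_not_isDiag [DecidableEq V] {p : Sym2 V} (hp : ¬p.IsDiag) (v : V) :
    pairIndicator p v = if v ∈ p then 1 else 0 := by
  induction p using Sym2.ind with
  | h a b =>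
    rw [Sym2.mk_isDiag_iff] at hp
    simp only [pairIndicator_apply hp, Sym2.mem_iff]

/-- The support of the indicator of a proper pair is the pair. [cite: KorteVygen2002, §12.2 (|T| = 2, T = {s, t})] -/
theorem supp_pairIndicator [Fintype V] [DecidableEq V] {a b : V} (hab : a ≠ b) :
    supp (pairIndicator s(a, b)) = {a, b} := by
  ext v
  rw [mem_supp_iff, pairIndicator_apply hab, mem_insert, mem_singleton]
  by_cases h : v = a ∨ v = b <;> simp [h]

/-- **Toggling two ends**: adding the indicator of a proper pair `{a, b}` to a binary vector replaces its
support by the symmetric difference with `{a, b}`. [cite: KorteVygen2002, §12.2 Thm 12.10 proof (J is a T-join iff J △ E⁻ is a (T △ T⁻)-join)] -/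
theorem supp_add_pairIndicator [Fintype V] [DecidableEq V] (x : V → ZMod 2) {a b : V} (hab : a ≠ b) :
    supp (x + pairIndicator s(a, b)) = supp x ∆ {a, b} := by
  ext v
  rw [mem_symmDiff, mem_supp_iff, mem_supp_iff, Pi.add_apply, pairIndicator_apply hab, mem_insert,
    mem_singleton]
  have h01 : ∀ y : ZMod 2, y = 0 ∨ y = 1 := by decide
  by_cases hv : v = a ∨ v = b
  · rcases h01 (x v) with h | h
    · simp [h, hv]
    · simp only [h, hv, if_true]; decide
  · rcases h01 (x v) with h | h
    · simp [h, hv]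
    · simp only [h, hv, if_false]; decide

/-- The **incidence matrix** of a graphlike fault model: the column of the fault `ℓ` is the indicator of
the two ends `ι ℓ` of its link. [cite: KorteVygen2002, §12.2 Def 12.5] -/
def incMatrix [DecidableEq V] (ι : E → Sym2 V) : Matrix V E (ZMod 2) :=
  Matrix.of fun v ℓ => pairIndicator (ι ℓ) v

/-- The **boundary / syndrome** of a chain `e` in a graphlike model, `∂e = incMatrix ι *ᵥ e`: the sites met
by an odd number of links of `e` (the set `T` of which `e` is a `T`-join).
[cite: KorteVygen2002, §12.2 Def 12.5 (T-join)] -/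
def graphSyn [DecidableEq V] [Fintype E] (ι : E → Sym2 V) (e : E → ZMod 2) : V → ZMod 2 :=
  incMatrix ι *ᵥ e

/-- The chains without boundary (`∅`-joins, Eulerian subgraphs) — the undetectable set of the decoding
problem. [cite: KorteVygen2002, §12.2 (T = ∅: the Eulerian subgraphs)] -/
def graphCycles [DecidableEq V] [Fintype E] (ι : E → Sym2 V) : Set (E → ZMod 2) :=
  {z | graphSyn ι z = 0}

section Syn

variable [DecidableEq V] [Fintype E] {ι : E → Sym2 V}

/-- `∂` is additive. [cite: DennisEtAl2002, §4.3 (∂ is linear: ∂(S + E) = ∂S + ∂E)] -/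
theorem graphSyn_add (e e' : E → ZMod 2) : graphSyn ι (e + e') = graphSyn ι e + graphSyn ι e' :=
  mulVec_add _ _ _

/-- `∂ 0 = 0`. [cite: DennisEtAl2002, §4.3 (the empty chain has no boundary)] -/
@[simp] theorem graphSyn_zero : graphSyn ι (0 : E → ZMod 2) = 0 :=
  mulVec_zero _

/-- `∂` of a finite sum of chains. [cite: KorteVygen2002, §12.2 proof of Prop 12.6 (J := E(P₁) △ ⋯ △ E(P_k) is a T-join)] -/
theorem graphSyn_sum {α : Type*} (s : Finset α) (f : α → E → ZMod 2) :
    graphSyn ι (∑ i ∈ s, f i) = ∑ i ∈ s, graphSyn ι (f i) :=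
  Matrix.mulVec_sum _ s f

/-- A chain and its correction have the same boundary iff their sum is a cycle. [cite: DennisEtAl2002, §4.3 (E′ = S + C′ with C′ a cycle iff ∂E′ = ∂S)] -/
theorem add_mem_graphCycles_iff (x e : E → ZMod 2) : x + e ∈ graphCycles ι ↔ graphSyn ι x = graphSyn ι e := by
  simp only [graphCycles, Set.mem_setOf_eq, graphSyn_add]
  constructor
  · intro h
    calc graphSyn ι x = graphSyn ι x + (graphSyn ι e + graphSyn ι e) := by rw [chain_add_self, add_zero]
      _ = graphSyn ι e := by rw [← add_assoc, h, zero_add]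
  · intro h
    rw [h, chain_add_self]

/-- The boundary of a single link is the indicator of its two ends. [cite: KorteVygen2002, §12.2 Def 12.5 (a single edge is a T-join for T = its two ends)] -/
theorem graphSyn_single [DecidableEq E] (ℓ : E) : graphSyn ι (Pi.single ℓ 1) = pairIndicator (ι ℓ) := by
  unfold graphSyn
  rw [mulVec_single_one]
  rfl

end Syn

/-! ### Link-connectivity and the shortest-chain distance -/

section Connectivity

variable [DecidableEq V] [Fintype E] {ι : E → Sym2 V}

/-- **Link-connectivity**: every two sites are joined by some chain. (definition)
[cite: KorteVygen2002, §12.2 Prop 12.6 (a T-join exists iff |V(C) ∩ T| is even for each component)] -/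
def IsLinkConnected (ι : E → Sym2 V) : Prop :=
  ∀ a b : V, ∃ γ : E → ZMod 2, graphSyn ι γ = pairIndicator s(a, b)

/-- Link-connectivity from a root: if every site is joined to a fixed `root` by a chain, every two sites are
joined (concatenate). [cite: KorteVygen2002, §12.2 Prop 12.6] -/
theorem isLinkConnected_of_root (root : V)
    (h : ∀ x : V, ∃ γ : E → ZMod 2, graphSyn ι γ = pairIndicator s(root, x)) : IsLinkConnected ι := by
  intro a b
  obtain ⟨γ₁, h₁⟩ := h a
  obtain ⟨γ₂, h₂⟩ := h b
  refine ⟨γ₁ + γ₂, ?_⟩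
  rw [graphSyn_add, h₁, h₂, Sym2.eq_swap (a := root) (b := a), pairIndicator_add_pairIndicator]

/-- The **shortest-chain distance**: the least number of links of a chain with boundary `{a, b}` (the
graph distance of the lattice; `0` by convention if no such chain exists). (definition)
[cite: KorteVygen2002, §12.2 proof of Thm 12.9 (metric closure: shortest x-y-paths)] -/
noncomputable def chainDist (ι : E → Sym2 V) (a b : V) : ℕ :=
  sInf {n | ∃ γ : E → ZMod 2, graphSyn ι γ = pairIndicator s(a, b) ∧ hammingNorm γ = n}

/-- The shortest-chain distance is attained. [cite: KorteVygen2002, §12.2 proof of Thm 12.9 (shortest x-y-paths exist; metric closure Cor 7.11)] -/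
theorem exists_chain_of_isLinkConnected (h : IsLinkConnected ι) (a b : V) :
    ∃ γ : E → ZMod 2, graphSyn ι γ = pairIndicator s(a, b) ∧ hammingNorm γ = chainDist ι a b := by
  obtain ⟨γ, hγ⟩ := h a b
  exact Nat.sInf_mem (s := {n | ∃ γ : E → ZMod 2, graphSyn ι γ = pairIndicator s(a, b) ∧ hammingNorm γ = n})
    ⟨hammingNorm γ, γ, hγ, rfl⟩

/-- Every chain with boundary `{a, b}` has at least `chainDist a b` links. [cite: KorteVygen2002, §12.2 proof of Thm 12.9 (c̄ = shortest-path distance)] -/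
theorem chainDist_le_hammingNorm {a b : V} {γ : E → ZMod 2} (hγ : graphSyn ι γ = pairIndicator s(a, b)) :
    chainDist ι a b ≤ hammingNorm γ :=
  Nat.sInf_le ⟨γ, hγ, rfl⟩

/-- The shortest-chain distance is symmetric. [cite: KorteVygen2002, §12.2 proof of Thm 12.9 (metric closure (Ḡ, c̄), Cor 7.11)] -/
theorem chainDist_comm (a b : V) : chainDist ι a b = chainDist ι b a := by
  simp only [chainDist, Sym2.eq_swap]

/-- The shortest-chain distance obeys the triangle inequality (concatenate chains). [cite: KorteVygen2002, §12.2 proof of Thm 12.9 (metric closure (Ḡ, c̄), Cor 7.11: c̄ is a metric)] -/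
theorem chainDist_triangle [DecidableEq E] (h : IsLinkConnected ι) (a b c : V) :
    chainDist ι a c ≤ chainDist ι a b + chainDist ι b c := by
  obtain ⟨γ₁, h₁, hn₁⟩ := exists_chain_of_isLinkConnected h a b
  obtain ⟨γ₂, h₂, hn₂⟩ := exists_chain_of_isLinkConnected h b c
  have hγ : graphSyn ι (γ₁ + γ₂) = pairIndicator s(a, c) := by
    rw [graphSyn_add, h₁, h₂, pairIndicator_add_pairIndicator]
  calc chainDist ι a c ≤ hammingNorm (γ₁ + γ₂) := chainDist_le_hammingNorm hγ
    _ ≤ hammingNorm γ₁ + hammingNorm γ₂ := hammingNorm_add_le_add γ₁ γ₂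
    _ = chainDist ι a b + chainDist ι b c := by rw [hn₁, hn₂]

/-- A single link has `chainDist ≤ 1` between its ends. [cite: KorteVygen2002, §12.2 proof of Thm 12.9 (c̄({x,y}) ≤ c({x,y}) for an edge)] -/
theorem chainDist_ends_le_one [DecidableEq E] (ℓ : E) (a b : V) (hℓ : ι ℓ = s(a, b)) : chainDist ι a b ≤ 1 := by
  have hγ : graphSyn ι (Pi.single ℓ 1) = pairIndicator s(a, b) := by rw [graphSyn_single, hℓ]
  refine (chainDist_le_hammingNorm hγ).trans ?_
  change (supp (Pi.single ℓ (1 : ZMod 2))).card ≤ 1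
  refine card_le_one.2 fun i hi j hj => ?_
  rw [mem_supp_iff] at hi hj
  by_contra hij
  rcases eq_or_ne i ℓ with rfl | hi'
  · exact hj (Pi.single_eq_of_ne (Ne.symm hij) _)
  · exact hi (Pi.single_eq_of_ne hi' _)

end Connectivity

end Literature.InformationTheory.QuantumCodes
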